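import Summits.CriticalPhenomena.Ising3DConformalLimit.Theorems.HarmonicMomentsIsotropyDilutionTransferDoublingA
import Literature.Probability.LatticeModels.SusceptibilityMeanFieldBound
import Literature.Probability.LatticeModels.CriticalTwoPointBounds
import Literature.Probability.LatticeModels.GKSInequalities

/-!
# Regular variation of the critical two-point mass, II: Karamata domination and doubling

Support file for item `DilutionTransfer` (stmt-CriticalPhenomena-6037) of route
`HarmonicMomentsIsotropy` (sub-problem `Ising3DConformalLimit`).

Continues `…DoublingA`:
* `ballSum_le_const_add_shellSum` — Karamata-type domination `∑_{‖δx‖≤1} ≤ C₀ + 3 ∑_{1/2<‖δx‖≤1}`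
  (dyadic induction on the shell growth);
* `ballSum_unbounded` — the ball sums diverge (`χ(β_c) = ∞`,
  `susceptibility_eq_top_of_criticalBeta_le`), hence `ballSum_le_four_mul_shellSum`;
* `cubeSum_ge_mul_ballSum` — **doubling**: every cube away from the origin carries a fixed
  fraction of the critical two-point mass of the ball at the same mesh.
-/

noncomputable section

open MeasureTheory Filter Topology Set
open scoped ENNReal NNReal BigOperators
open Literature.Probability.LatticeModels

namespace Summit.CriticalPhenomena.Ising3DConformalLimit.Theorems.HarmonicMomentsIsotropy.LatticeSums

/-! ## Karamata: the ball mass is dominated by the top shell -/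

open scoped Classical in
/-- **Karamata-type domination.** Under a scale-covariant non-degenerate pointwise limit there are
`C₀` and `δ₀ > 0` with `∑_{‖δx‖≤1} ⟨σ₀σₓ⟩_{β_c} ≤ C₀ + 3 ∑_{1/2<‖δx‖≤1} ⟨σ₀σₓ⟩_{β_c}` for all
`0 < δ ≤ δ₀` (geometric growth of the dyadic shells, summed). -/
theorem ballSum_le_const_add_shellSum {ρ : ℝ → ℝ} {Δ : ℝ} {S : CorrFamily 3}
    (hρ : ∀ δ ∈ Set.Ioc (0 : ℝ) 1, 0 < ρ δ)
    (hlim : HasPointwiseScalingLimit (criticalCorr 3) ρ S) (hsc : IsScaleCovariant Δ S)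
    (hnd : IsNondegenerateTwoPoint S) :
    ∃ C₀ : ℝ, ∃ δ₀ > 0, ∀ δ : ℝ, 0 < δ → δ ≤ δ₀ →
      (∑' x : Site 3, if (δ • fun i => ((x i : ℤ) : ℝ)) ∈ Metric.closedBall (0 : Fin 3 → ℝ) 1
          then criticalTwoPoint 3 x else 0) ≤
        C₀ + 3 * ∑' x : Site 3, (if (δ • fun i => ((x i : ℤ) : ℝ)) ∈
          Metric.closedBall (0 : Fin 3 → ℝ) 1 \ Metric.closedBall 0 (1 / 2)
          then criticalTwoPoint 3 x else 0) := by
  set ba : ℝ → ℝ := fun δ => ∑' x : Site 3,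
    (if (δ • fun i => ((x i : ℤ) : ℝ)) ∈ Metric.closedBall (0 : Fin 3 → ℝ) 1
      then criticalTwoPoint 3 x else 0) with hba
  set sh : ℝ → ℝ := fun δ => ∑' x : Site 3,
    (if (δ • fun i => ((x i : ℤ) : ℝ)) ∈ Metric.closedBall (0 : Fin 3 → ℝ) 1 \ Metric.closedBall 0 (1 / 2)
      then criticalTwoPoint 3 x else 0) with hsh
  obtain ⟨δ₄, hδ₄, hgrowth⟩ := shellSum_growth hρ hlim hsc hnd
  set δ₀ : ℝ := δ₄ / 2 with hδ₀
  have hδ₀pos : 0 < δ₀ := by positivity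
  set C₀ : ℝ := ba (δ₀ / 2) with hC₀
  refine ⟨C₀, δ₀, hδ₀pos, ?_⟩
  -- the dyadic induction
  have hsplit : ∀ δ : ℝ, 0 < δ → ba δ = ba (2 * δ) + sh δ := fun δ hδ =>
    ballSum_eq_ballSum_two_mul_add_shellSum hδ
  have hsh0 : ∀ δ, 0 ≤ sh δ := fun δ => shellSum_nonneg δ _
  have hind : ∀ n : ℕ, ∀ δ : ℝ, δ₀ / 2 ^ (n + 1) < δ → δ ≤ δ₀ / 2 ^ n → ba δ ≤ C₀ + 3 * sh δ := by
    intro n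
    induction n with
    | zero =>
      intro δ h1 h2
      rw [pow_one] at h1
      have hδ : 0 < δ := lt_trans (by positivity) h1
      calc ba δ ≤ ba (δ₀ / 2) := ballSum_antitone (by positivity) h1.le
        _ = C₀ := rfl
        _ ≤ C₀ + 3 * sh δ := by linarith [hsh0 δ]
    | succ n ih =>
      intro δ h1 h2
      have hδ : 0 < δ := lt_trans (by positivity) h1
      have h1' : δ₀ / 2 ^ (n + 1) < 2 * δ := by
        rw [pow_succ] at h1
        have := (div_lt_iff₀ (by positivity : (0 : ℝ) < 2 ^ (n + 1) * 2)).1 h1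
        rw [div_lt_iff₀ (by positivity)]
        linarith
      have h2' : 2 * δ ≤ δ₀ / 2 ^ n := by
        rw [pow_succ] at h2
        have := (le_div_iff₀ (by positivity : (0 : ℝ) < 2 ^ n * 2)).1 h2
        rw [le_div_iff₀ (by positivity)]
        linarith
      have hIH := ih (2 * δ) h1' h2'
      -- shell growth at mesh `2δ`
      have h2δ : 2 * δ < δ₄ := by
        have : 2 * δ ≤ δ₀ := h2'.trans (div_le_self hδ₀pos.le (one_le_pow₀ (by norm_num)))
        rw [hδ₀] at this; linarith
      have hg := hgrowth (2 * δ) (by positivity) h2δ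
      rw [show 2 * δ / 2 = δ by ring] at hg
      rw [hsplit δ hδ]
      linarith
  intro δ hδ hδδ₀
  -- locate `δ` in a dyadic interval below `δ₀`
  obtain ⟨n, hn1, hn2⟩ := exists_nat_pow_near (x := δ₀ / δ)
    (by rw [le_div_iff₀ hδ, one_mul]; exact hδδ₀) one_lt_two
  refine hind n δ ?_ ?_
  · rw [div_lt_iff₀ (by positivity)]
    have := (div_lt_iff₀ hδ).1 hn2
    linarith
  · rw [le_div_iff₀ (by positivity)]
    have := (le_div_iff₀ hδ).1 hn1
    linarith

/-! ## The ball mass diverges (the susceptibility is infinite at `β_c`) -/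

open scoped Classical in
/-- **The ball sums diverge**: `∑_{‖δx‖≤1} ⟨σ₀σₓ⟩_{β_c} → ∞` as `δ → 0⁺`, because
`χ(β_c) = ∑ₓ ⟨σ₀σₓ⟩_{β_c} = ∞` (`susceptibility_eq_top_of_criticalBeta_le`). -/
theorem ballSum_unbounded (C : ℝ) : ∃ δ₁ > 0, ∀ δ : ℝ, 0 < δ → δ < δ₁ →
    C < ∑' x : Site 3, (if (δ • fun i => ((x i : ℤ) : ℝ)) ∈ Metric.closedBall (0 : Fin 3 → ℝ) 1
      then criticalTwoPoint 3 x else 0) := by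
  have hchi : susceptibility 3 (criticalBeta 3) = ⊤ :=
    susceptibility_eq_top_of_criticalBeta_le (by norm_num) le_rfl
  have heq : ∀ x : Site 3, twoPointFree 3 (criticalBeta 3) x = criticalTwoPoint 3 x := fun x =>
    (twoPointPlus_criticalBeta_eq_twoPointFree_holds (d := 3) (by norm_num) x).symm
  rw [susceptibility, ENNReal.tsum_eq_iSup_sum] at hchi
  have hlt : ENNReal.ofReal (|C| + 1) < ⨆ s : Finset (Site 3), ∑ x ∈ s,
      ENNReal.ofReal (twoPointFree 3 (criticalBeta 3) x) := by
    rw [hchi]; exact ENNReal.ofReal_lt_top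
  rw [lt_iSup_iff] at hlt
  obtain ⟨s, hs⟩ := hlt
  rw [← ENNReal.ofReal_sum_of_nonneg (fun x _ => by rw [heq]; exact criticalTwoPoint_nonneg' x),
    ENNReal.ofReal_lt_ofReal_iff_of_nonneg (by positivity)] at hs
  simp_rw [heq] at hs
  obtain ⟨N, hN⟩ := exists_forall_subset_box (d := 3) s
  refine ⟨1 / ((N : ℝ) + 1), by positivity, fun δ hδ hδ₁ => ?_⟩
  have hsum := summable_norm_ite_mem hδ (subset_refl (Metric.closedBall (0 : Fin 3 → ℝ) 1))
    (criticalTwoPoint 3)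
  calc C < |C| + 1 := by linarith [le_abs_self C]
    _ < ∑ x ∈ s, criticalTwoPoint 3 x := hs
    _ = ∑ x ∈ s, (if (δ • fun i => ((x i : ℤ) : ℝ)) ∈ Metric.closedBall (0 : Fin 3 → ℝ) 1
          then criticalTwoPoint 3 x else 0) := by
        refine Finset.sum_congr rfl fun x hx => ?_
        rw [if_pos]
        rw [Metric.mem_closedBall, dist_zero_right, norm_smul, Real.norm_eq_abs, abs_of_pos hδ,
          norm_intCast_eq]
        have hxN : ‖x‖ ≤ N := by
          have hxb := hN N le_rfl hx
          rw [mem_box] at hxb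
          rw [pi_norm_le_iff_of_nonneg N.cast_nonneg]
          intro i
          rw [Int.norm_eq_abs]
          have := hxb i
          rw [abs_le]
          exact ⟨by exact_mod_cast this.1, by exact_mod_cast this.2⟩
        calc δ * ‖x‖ ≤ 1 / ((N : ℝ) + 1) * N := by gcongr
          _ ≤ 1 := by rw [div_mul_eq_mul_div, one_mul, div_le_one (by positivity)]; linarith
    _ ≤ _ := hsum.of_norm.sum_le_tsum s fun x _ => by
        split_ifs; exacts [criticalTwoPoint_nonneg' x, le_refl _]

open scoped Classical in
/-- **The ball mass is at most four times the top shell mass** for small mesh. -/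
theorem ballSum_le_four_mul_shellSum {ρ : ℝ → ℝ} {Δ : ℝ} {S : CorrFamily 3}
    (hρ : ∀ δ ∈ Set.Ioc (0 : ℝ) 1, 0 < ρ δ)
    (hlim : HasPointwiseScalingLimit (criticalCorr 3) ρ S) (hsc : IsScaleCovariant Δ S)
    (hnd : IsNondegenerateTwoPoint S) :
    ∃ δ₀ > 0, ∀ δ : ℝ, 0 < δ → δ < δ₀ →
      (∑' x : Site 3, if (δ • fun i => ((x i : ℤ) : ℝ)) ∈ Metric.closedBall (0 : Fin 3 → ℝ) 1
          then criticalTwoPoint 3 x else 0) ≤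
        4 * ∑' x : Site 3, (if (δ • fun i => ((x i : ℤ) : ℝ)) ∈
          Metric.closedBall (0 : Fin 3 → ℝ) 1 \ Metric.closedBall 0 (1 / 2)
          then criticalTwoPoint 3 x else 0) := by
  obtain ⟨C₀, δ₀, hδ₀, hK⟩ := ballSum_le_const_add_shellSum hρ hlim hsc hnd
  obtain ⟨δ₁, hδ₁, hU⟩ := ballSum_unbounded (4 * |C₀|)
  refine ⟨min δ₀ δ₁, lt_min hδ₀ hδ₁, fun δ hδ hδm => ?_⟩
  have h1 := hK δ hδ (le_of_lt (lt_of_lt_of_le hδm (min_le_left _ _)))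
  have h2 := hU δ hδ (lt_of_lt_of_le hδm (min_le_right _ _))
  have hC : C₀ ≤ |C₀| := le_abs_self _
  linarith

/-! ## Doubling: cubes avoiding the origin carry a fixed fraction of the ball mass -/

open scoped Classical in
/-- **Critical mass of a cube versus the ball.** Under a scale-covariant non-degenerate pointwise
limit, every closed cube `{‖z - w‖_∞ ≤ r}` (`r > 0`) at positive distance from the origin carries,
at every small mesh `δ`, at least a fixed fraction `q > 0` of the critical two-point mass of the
ball `{‖δx‖_∞ ≤ 1}`: `q ∑_{‖δx‖≤1} ⟨σ₀σₓ⟩_{β_c} ≤ ∑_{δx ∈ cube} ⟨σ₀σₓ⟩_{β_c}`. -/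
theorem cubeSum_ge_mul_ballSum {ρ : ℝ → ℝ} {Δ : ℝ} {S : CorrFamily 3}
    (hρ : ∀ δ ∈ Set.Ioc (0 : ℝ) 1, 0 < ρ δ)
    (hlim : HasPointwiseScalingLimit (criticalCorr 3) ρ S) (hsc : IsScaleCovariant Δ S)
    (hnd : IsNondegenerateTwoPoint S) (w : Fin 3 → ℝ) {r η : ℝ} (hr : 0 < r) (hη : 0 < η)
    (hw : r + η < ‖w‖) :
    ∃ q > 0, ∃ δ₀ > 0, ∀ δ : ℝ, 0 < δ → δ < δ₀ →
      q * (∑' x : Site 3, if (δ • fun i => ((x i : ℤ) : ℝ)) ∈ Metric.closedBall (0 : Fin 3 → ℝ) 1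
          then criticalTwoPoint 3 x else 0) ≤
        ∑' x : Site 3, (if (δ • fun i => ((x i : ℤ) : ℝ)) ∈ Metric.closedBall w r
          then criticalTwoPoint 3 x else 0) := by
  set ba : ℝ → ℝ := fun δ => ∑' x : Site 3,
    (if (δ • fun i => ((x i : ℤ) : ℝ)) ∈ Metric.closedBall (0 : Fin 3 → ℝ) 1
      then criticalTwoPoint 3 x else 0) with hba
  set sh : ℝ → ℝ := fun δ => ∑' x : Site 3,
    (if (δ • fun i => ((x i : ℤ) : ℝ)) ∈ Metric.closedBall (0 : Fin 3 → ℝ) 1 \ Metric.closedBall 0 (1 / 2)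
      then criticalTwoPoint 3 x else 0) with hsh
  set cu : ℝ → ℝ := fun δ => ∑' x : Site 3,
    (if (δ • fun i => ((x i : ℤ) : ℝ)) ∈ Metric.closedBall w r then criticalTwoPoint 3 x else 0)
    with hcu
  set I₁ : ℝ := ∫ z in Metric.closedBall (0 : Fin 3 → ℝ) 1 \ Metric.closedBall 0 (1 / 2),
    S 2 ![0, WithLp.toLp 2 z] with hI₁
  set IQ : ℝ := ∫ z in Metric.closedBall w r, S 2 ![0, WithLp.toLp 2 z] with hIQ
  have hI₁ : 0 < I₁ := shellIntegral_pos hlim hnd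
  -- positivity of the cube integral
  have hKQ : IsCompact (Metric.closedBall w r) := isCompact_closedBall w r
  have h0Q : (0 : Fin 3 → ℝ) ∉ Metric.closedBall w r := by
    rw [Metric.mem_closedBall, dist_zero_left]; linarith
  have hIQ0 : 0 < IQ :=
    setIntegral_limitTwoPoint_pos hlim hnd hKQ h0Q subset_rfl measurableSet_closedBall hr subset_rfl
  -- the limits of the rescaled shell and cube sums
  have hA : Tendsto (fun δ => δ ^ 3 * ρ δ ^ 2 * sh δ) (𝓝[>] 0) (𝓝 I₁) :=
    tendsto_rescaled_latticeSum hlim 0 (a := 1 / 2) (b := 1) (η := 1 / 4) (by norm_num)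
      (Or.inr (by rw [norm_zero]; norm_num))
  have hB : Tendsto (fun δ => δ ^ 3 * ρ δ ^ 2 * cu δ) (𝓝[>] 0) (𝓝 IQ) := by
    have h := tendsto_rescaled_latticeSum hlim w (a := -1) (b := r) (η := η) hη (Or.inl hw)
    have hempty : Metric.closedBall w (-1 : ℝ) = ∅ := Metric.closedBall_eq_empty.2 (by norm_num)
    simp only [hempty, sdiff_empty] at h
    exact h
  -- eventually: `δ³ρ² sh ≤ 2 I₁`, `δ³ρ² cu ≥ IQ/2`, `ba ≤ 4 sh`, `δ ≤ 1`
  obtain ⟨δa, hδa, ha⟩ := exists_of_eventually_nhdsGT (hA.eventually_lt_const (by linarith : I₁ < 2 * I₁))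
  obtain ⟨δb, hδb, hb⟩ := exists_of_eventually_nhdsGT (hB.eventually_const_lt (by linarith : IQ / 2 < IQ))
  obtain ⟨δc, hδc, hc⟩ := ballSum_le_four_mul_shellSum hρ hlim hsc hnd
  refine ⟨IQ / (16 * I₁), by positivity, min (min δa δb) (min δc 1), by positivity, fun δ hδ hδm => ?_⟩
  have hδa' : δ < δa := lt_of_lt_of_le hδm ((min_le_left _ _).trans (min_le_left _ _))
  have hδb' : δ < δb := lt_of_lt_of_le hδm ((min_le_left _ _).trans (min_le_right _ _))
  have hδc' : δ < δc := lt_of_lt_of_le hδm ((min_le_right _ _).trans (min_le_left _ _))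
  have hδ1 : δ ≤ 1 := (lt_of_lt_of_le hδm ((min_le_right _ _).trans (min_le_right _ _))).le
  have h1 : δ ^ 3 * ρ δ ^ 2 * sh δ < 2 * I₁ := ha δ hδ hδa'
  have h2 : IQ / 2 < δ ^ 3 * ρ δ ^ 2 * cu δ := hb δ hδ hδb'
  have h3 : ba δ ≤ 4 * sh δ := hc δ hδ hδc'
  have hρδ : 0 < ρ δ := hρ δ ⟨hδ, hδ1⟩
  have hfac : 0 < δ ^ 3 * ρ δ ^ 2 := by positivity
  -- `q · ba · (δ³ρ²) ≤ (IQ/(16 I₁)) · 8 I₁ = IQ/2 ≤ δ³ρ² cu`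
  have h4 : δ ^ 3 * ρ δ ^ 2 * ba δ ≤ 8 * I₁ := by nlinarith
  have h5 : δ ^ 3 * ρ δ ^ 2 * (IQ / (16 * I₁) * ba δ) ≤ δ ^ 3 * ρ δ ^ 2 * cu δ := by
    calc δ ^ 3 * ρ δ ^ 2 * (IQ / (16 * I₁) * ba δ) = IQ / (16 * I₁) * (δ ^ 3 * ρ δ ^ 2 * ba δ) := by
          ring
      _ ≤ IQ / (16 * I₁) * (8 * I₁) := mul_le_mul_of_nonneg_left h4 (by positivity)
      _ = IQ / 2 := by field_simp; ring
      _ ≤ δ ^ 3 * ρ δ ^ 2 * cu δ := h2.le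
  exact le_of_mul_le_mul_left h5 hfac

end Summit.CriticalPhenomena.Ising3DConformalLimit.Theorems.HarmonicMomentsIsotropy.LatticeSums

end
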